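import Literature.NumberTheory.IwasawaTheory.RatPRationalZpExtension
import Literature.NumberTheory.IwasawaTheory.GreenbergCyclicOrderP
import Literature.NumberTheory.IwasawaTheory.ClassicalMuVanishesUnramifiedClassesTower
import Literature.NumberTheory.EllipticCurves.GreenbergSelmerDualDataExistsProofs
import HarnessLib

/-!
# Greenberg, LNM 1716, §5 Lemma 5.9 — the TRIVIAL-MODULE case is a theorem: for `p` odd,
# `H¹(ℚ_{{p,∞}}/ℚ_∞, Θ) = 0` for every finite abelian `p`-group `Θ` with trivial `Γ_ℚ`-action

`Proofs`-style file in topic `NumberTheory/IwasawaTheory` (namespace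
`Literature.NumberTheory.IwasawaTheory.GreenbergCyclicOrderPTrivial`): THEOREMS ONLY (no definition, no named
fact, no instance, no `sorry`).  Written by the prover seat `bsd-eis-lam-a` g19 (cell `bsd-eis`, route
`EisensteinPrimes`, crux 5 stmt-BirchSwinnertonDyer-19035 `MazurMCOnX1RankZero`, line `interlude_with_torsion`
v13, whose registered PUB stub `stub_publishedL59 : IwasawaTheory.greenberg1999_lemma59_even_finite` is
Greenberg's Lemma 5.9 «`p` odd, `#Θ = p`, `Θ` EVEN ⟹ `H¹(ℚ_Σ/ℚ_∞, Θ)` finite», road B's input [Even];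
`--supports` that item, closes nothing: the stub is the statement for EVERY even `Θ`; here the case of TRIVIAL
action — the sub-population «rational `p`-torsion / trivial isogeny character» of the type-A rows — is PROVED;
the case `θ ≠ 𝟙` even is Iwasawa's rank theorem plus Ferrero–Washington read through the reflection theorem and
stays a named fact).

## What is proved

Let `p` be an odd prime, `κ : ZpExtension ℚ p` ANY `ℤ_p`-extension of `ℚ` (`ker κ = Gal(ℚ̄/ℚ_∞)`, layers
`Λ_n = Gal(ℚ̄/ℚ_n)`), `Θ` an abelian group of `p`-power order with TRIVIAL `Γ_ℚ`-action.

* `evalH1_eq_zero_of_mem_inertia_of_notMem` — classes of `unramifiedOutside H Θ p ∅` die on every inertia group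
  above the places `v ∤ p` (Greenberg–Vatsal's condition at all conjugates).
* **`unramifiedOutside_kerSubgroup_eq_bot_of_trivial`** — `unramifiedOutside (ker κ) Θ p ∅ = ⊥`: a class `c` is
  fixed by `conj_{γ^{pⁿ}}` (continuity, `exists_conjH1_pow_prime_pow_eq`), hence `c = res y` for a class `y` of the
  layer `Λ_n` (Greenberg's Lemma 3.2, `ClassicalMuVanishesUnramifiedClasses.exists_resOfLe_eq`); `y` is a continuous
  homomorphism `Λ_n → Θ` killing every inertia group `I_𝔓`, `𝔓 ∤ p` (these lie in `ker κ`, where `y` restricts to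
  `c`); the normal core `N` of `ker y` is open (it contains an open normal subgroup,
  `ProfiniteGrp.exist_openNormalSubgroup_sub_open_nhds_of_one`), contains the ramification subgroup outside `p`
  (conjugates of inertia groups are inertia groups), and `Γ_ℚ/N` is a `p`-group (`g^{pⁿ} ∈ Λ_n` and `#Θ` kills
  `Λ_n/N`); by `RatPRational.kerSubgroup_le_of_isPGroup_quotient` («`ℚ` is `p`-rational»), `ker κ ≤ N ≤ ker y`,
  whence `c = res y = 0`.
* `finite_unramifiedOutside_kerSubgroup_of_trivial` — set form (the subgroup is `{0}`, hence finite).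
* `greenberg1999_lemma59_even_finite_of_trivial` — Greenberg's Lemma 5.9 in the exact binder shape of the named
  fact `IwasawaTheory.greenberg1999_lemma59_even_finite` (`GreenbergCyclicOrderP.lean`) with the extra hypothesis
  «`Γ_ℚ` acts trivially on `Θ`» (then the evenness, continuity and `IsCyclotomic` binders are automatic / unused).

Mathematically this is the case `θ = 1` of Greenberg's proof (p. 142 of the LNM volume: «Iwasawa proved that
`Y^θ` is `Λ`-torsion if `θ` is even … the `μ`-invariant of `Y^θ` vanishes»): over `ℚ` with trivial `θ` one has
`Y^θ = Gal(M_∞/ℚ_∞) = 0` because `ℚ` is `p`-rational.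

HONEST FRAMING: helper theorems; no case of BSD, no main conjecture and no summit statement is proved; the
registered stub `stub_publishedL59` (all even `Θ`) is NOT discharged by this file.

## References

* R. Greenberg, *Iwasawa theory for elliptic curves*, LNM 1716 (1999), §3 Lemma 3.2, §5 Lemma 5.9 (p. 142).
  [Greenberg1999LNM]
* R. Greenberg, V. Vatsal, *On the Iwasawa invariants of elliptic curves*, Invent. Math. 142 (2000), §2 pp. 16–17.
  [GreenbergVatsal2000]
* L. C. Washington, *Introduction to Cyclotomic Fields*, 2nd ed. (1997), §13.1, Prop. 13.2. [Washington1997]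
-/

set_option autoImplicit false

noncomputable section

open scoped Classical Pointwise NumberField
open NumberField IsDedekindDomain Field IntermediateField

namespace Literature.NumberTheory.IwasawaTheory.GreenbergCyclicOrderPTrivial

open Literature.NumberTheory.EllipticCurves Literature.NumberTheory.EllipticCurves.GreenbergSelmer
  Literature.NumberTheory.EllipticCurves.GreenbergVatsal2000 Literature.NumberTheory.GaloisRepresentations
  Literature.NumberTheory.NumberFields Literature.NumberTheory.IwasawaTheory.ClassicalMuVanishesUnramifiedClasses
  Literature.NumberTheory.IwasawaTheory.RatPRational

variable {p : ℕ} [Fact p.Prime]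

/-! ## §3 Every class of `H¹(ℚ_∞, Θ)` unramified outside `p` vanishes (`Θ` trivial, `p`-power order) -/

omit [Fact p.Prime] in
/-- **Classes of `unramifiedOutside H Θ p ∅` die on every inertia group above the places `v ∤ p`** (trivial
action): for `𝔓` over `v` with `p ∉ v` and `x ∈ H ∩ I_𝔓`, the homomorphism of `c` vanishes at `x` (the
Greenberg–Vatsal condition at every conjugate, `resOfLe_inertia_inf_eq_zero_of_mem_unramifiedOutside`; the
`p ∣ 1`-free twin of `ClassicalMuVanishesUnramifiedClasses.cocycleOf_apply_eq_zero_of_mem_inertia`).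
[cite: GreenbergVatsal2000, §2 pp. 16–17] -/
theorem evalH1_eq_zero_of_mem_inertia_of_notMem {Θ : Type} [AddCommGroup Θ]
    [DistribMulAction (absoluteGaloisGroup ℚ) Θ] [TopologicalSpace Θ] [DiscreteTopology Θ]
    (htriv : ∀ (σ : absoluteGaloisGroup ℚ) (m : Θ), σ • m = m)
    (H : Subgroup (absoluteGaloisGroup ℚ)) [H.Normal] {c : subgroupH1 H Θ}
    (hc : c ∈ unramifiedOutside H Θ p (∅ : Set (HeightOneSpectrum (𝓞 ℚ))))
    {v : HeightOneSpectrum (𝓞 ℚ)} (hv : ((p : ℕ) : 𝓞 ℚ) ∉ v.asIdeal)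
    {𝔓 : Ideal (absIntegers (𝓞 ℚ) ℚ)} (h𝔓 : 𝔓 ∈ v.primesAbove) (x : H)
    (hx : (x : absoluteGaloisGroup ℚ) ∈ 𝔓.inertia (absoluteGaloisGroup ℚ)) :
    evalH1 (smul_eq_of_trivial htriv H) x c = 0 := by
  haveI := h𝔓.1
  have h1 := resOfLe_inertia_inf_eq_zero_of_mem_unramifiedOutside (p := p)
    (S₀ := (∅ : Set (HeightOneSpectrum (𝓞 ℚ)))) hc (Set.notMem_empty v) hv h𝔓
  rw [← oneCocycleClass_cocycleOf (smul_eq_of_trivial htriv H) c,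
    CocycleCriteria.resOfLe_oneCocycleClass_eq_zero_iff] at h1
  obtain ⟨a, ha⟩ := h1
  have h2 := ha ⟨(x : absoluteGaloisGroup ℚ), Subgroup.mem_inf.2 ⟨hx, x.2⟩⟩
  have hincl : Subgroup.inclusion (inf_le_right : 𝔓.inertia (absoluteGaloisGroup ℚ) ⊓ H ≤ H)
      ⟨(x : absoluteGaloisGroup ℚ), Subgroup.mem_inf.2 ⟨hx, x.2⟩⟩ = x := Subtype.ext rfl
  rw [hincl] at h2
  change (cocycleOf H Θ (smul_eq_of_trivial htriv H) c).1 x = 0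
  rw [h2, sub_eq_zero]
  exact htriv _ a

/-- **Greenberg's Lemma 5.9, trivial module: `H¹(ℚ_{{p,∞}}/ℚ_∞, Θ) = 0`.**  For an odd prime `p`, any
`ℤ_p`-extension `κ` of `ℚ` and any abelian group `Θ` of `p`-power order with TRIVIAL `Γ_ℚ`-action, the subgroup
`unramifiedOutside (ker κ) Θ p ∅ ⊆ H¹(Gal(ℚ̄/ℚ_∞), Θ)` of classes all of whose conjugates are unramified at
every place not above `p` is TRIVIAL.  Proof: `c` is fixed by `conj_{γ^{pⁿ}}` (`exists_conjH1_pow_prime_pow_eq`),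
so `c = res y` with `y ∈ H¹(Λ_n, Θ) = Hom_cont(Λ_n, Θ)` (Greenberg's Lemma 3.2, `exists_resOfLe_eq`); the normal
core `N` of `ker y` is open (it contains an open normal subgroup,
`ProfiniteGrp.exist_openNormalSubgroup_sub_open_nhds_of_one`), contains every `I_𝔓`, `𝔓 ∤ p`
(`I_𝔓 ≤ ker κ` and `y|_{ker κ} = c` kills it, `evalH1_eq_zero_of_mem_inertia_of_notMem`; conjugates of inertia
groups are inertia groups), and `Γ_ℚ/N` is a `p`-group (`g^{pⁿ} ∈ Λ_n`, and `#Θ` kills `Λ_n/N`); by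
`kerSubgroup_le_of_isPGroup_quotient`, `ker κ ≤ N ≤ ker y`, whence `c = 0`.
[cite: Greenberg1999LNM, §5 Lemma 5.9 (p. 142) and §3 Lemma 3.2] [cite: Washington1997, §13.1 Prop. 13.2] -/
theorem unramifiedOutside_kerSubgroup_eq_bot_of_trivial (hp2 : p ≠ 2) (κ : ZpExtension ℚ p)
    {Θ : Type} [AddCommGroup Θ] [DistribMulAction (absoluteGaloisGroup ℚ) Θ] [TopologicalSpace Θ]
    [DiscreteTopology Θ] (hcard : ∃ k : ℕ, Nat.card Θ = p ^ k)
    (htriv : ∀ (σ : absoluteGaloisGroup ℚ) (m : Θ), σ • m = m) :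
    unramifiedOutside κ.kerSubgroup Θ p (∅ : Set (HeightOneSpectrum (𝓞 ℚ))) = ⊥ := by
  have hpr : p.Prime := Fact.out
  obtain ⟨k, hk⟩ := hcard
  haveI : Finite Θ := Nat.finite_of_card_ne_zero (by rw [hk]; exact (pow_pos hpr.pos k).ne')
  have hpM : ∀ m : Θ, p ^ k • m = 0 := fun m => by rw [← hk]; exact card_nsmul_eq_zero'
  rw [eq_bot_iff]
  intro c hc
  rw [AddSubgroup.mem_bot]
  -- Step 1: `c` is fixed by `γ^{pⁿ}`, hence the restriction of a class `y` of the layer `Λ_n`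
  obtain ⟨γ, hγ⟩ := κ.surjective (Multiplicative.ofAdd 1)
  have hγ' : κ.IsTopGenerator γ := hγ
  have hstab : ∀ m : Θ,
      IsOpen (MulAction.stabilizer (absoluteGaloisGroup ℚ) m : Set (absoluteGaloisGroup ℚ)) := by
    intro m
    have : (MulAction.stabilizer (absoluteGaloisGroup ℚ) m : Set (absoluteGaloisGroup ℚ)) = Set.univ :=
      Set.eq_univ_of_forall fun σ => htriv σ m
    rw [this]; exact isOpen_univ
  obtain ⟨n, hn⟩ := exists_conjH1_pow_prime_pow_eq κ Θ hstab hγ' c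
  obtain ⟨y, hy⟩ := exists_resOfLe_eq κ htriv (fun m => ⟨k, hpM m⟩) hγ' n c hn
  -- notation: `H = ker κ`, `Λ = Λ_n` (plain terms; no local definitions, to keep rewriting syntactic)
  have htrivΛ : ∀ (x : κ.layerSubgroup n) (m : Θ), x • m = m := smul_eq_of_trivial htriv (κ.layerSubgroup n)
  have htrivH : ∀ (x : κ.kerSubgroup) (m : Θ), x • m = m := smul_eq_of_trivial htriv κ.kerSubgroup
  have hΛn : (κ.layerSubgroup n).Normal := κ.layerSubgroup_normal n
  -- Step 2: the homomorphism of `y` and the open subgroup `U = ker y ≤ Γ`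
  set φ : κ.layerSubgroup n → Θ := fun x => evalH1 htrivΛ x y with hφ
  have hφmul : ∀ a b : κ.layerSubgroup n, φ (a * b) = φ a + φ b := fun a b => evalH1_mul htrivΛ a b y
  have hφcont : Continuous φ := (cocycleOf (κ.layerSubgroup n) Θ htrivΛ y).1.continuous
  have hφone : φ 1 = 0 := map_one_eq_zero_of_map_mul hφmul
  have hφpow : ∀ (a : κ.layerSubgroup n) (j : ℕ), φ (a ^ j) = j • φ a := by
    intro a j
    induction j with
    | zero => rw [pow_zero, zero_smul, hφone]
    | succ j ih => rw [pow_succ, hφmul, ih, succ_nsmul]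
  let ψ : κ.layerSubgroup n →* Multiplicative Θ :=
    { toFun := fun x => Multiplicative.ofAdd (φ x)
      map_one' := by rw [hφone]; rfl
      map_mul' := fun a b => by rw [hφmul]; rfl }
  have hψker : ∀ x : κ.layerSubgroup n, x ∈ ψ.ker ↔ φ x = 0 := fun x => by
    rw [MonoidHom.mem_ker]
    exact Multiplicative.ofAdd.injective.eq_iff' rfl
  set U : Subgroup (absoluteGaloisGroup ℚ) := ψ.ker.map (κ.layerSubgroup n).subtype with hU
  have hmemU : ∀ g : absoluteGaloisGroup ℚ, g ∈ U ↔ ∃ hg : g ∈ κ.layerSubgroup n, φ ⟨g, hg⟩ = 0 := by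
    intro g
    rw [hU, Subgroup.mem_map]
    constructor
    · rintro ⟨x, hx, rfl⟩
      exact ⟨x.2, by rw [← hψker]; exact hx⟩
    · rintro ⟨hg, h0⟩
      exact ⟨⟨g, hg⟩, (hψker _).2 h0, rfl⟩
  have hUΛ : U ≤ κ.layerSubgroup n := by
    intro g hg
    obtain ⟨hg', -⟩ := (hmemU g).1 hg
    exact hg'
  have hUopen : IsOpen (U : Set (absoluteGaloisGroup ℚ)) := by
    have hker_open : IsOpen ((ψ.ker : Subgroup (κ.layerSubgroup n)) : Set (κ.layerSubgroup n)) := by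
      have e : ((ψ.ker : Subgroup (κ.layerSubgroup n)) : Set (κ.layerSubgroup n)) = φ ⁻¹' {0} := by
        ext x
        rw [SetLike.mem_coe, hψker, Set.mem_preimage, Set.mem_singleton_iff]
      rw [e]
      exact (isOpen_discrete ({0} : Set Θ)).preimage hφcont
    have himg : (U : Set (absoluteGaloisGroup ℚ)) =
        Subtype.val '' ((ψ.ker : Subgroup (κ.layerSubgroup n)) : Set (κ.layerSubgroup n)) := by
      rw [hU, Subgroup.coe_map]
      rfl
    rw [himg]
    exact (κ.isOpen_layerSubgroup n).isOpenMap_subtype_val _ hker_open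
  -- Step 3: the normal core `N` of `U`: open, normal, `N ≤ U ≤ Λ`
  set N : Subgroup (absoluteGaloisGroup ℚ) := U.normalCore with hN
  have hNU : N ≤ U := Subgroup.normalCore_le U
  obtain ⟨N₀, hN₀⟩ := ProfiniteGrp.exist_openNormalSubgroup_sub_open_nhds_of_one hUopen U.one_mem
  have hN₀N : (N₀ : Subgroup (absoluteGaloisGroup ℚ)) ≤ N :=
    Subgroup.normal_le_normalCore.mpr fun g hg => hN₀ hg
  have hNo : IsOpen (N : Set (absoluteGaloisGroup ℚ)) := Subgroup.isOpen_mono hN₀N N₀.isOpen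
  -- Step 4: `N` contains every inertia group above `v ∤ p`
  have hIU : ∀ {v : HeightOneSpectrum (𝓞 ℚ)}, ((p : ℕ) : 𝓞 ℚ) ∉ v.asIdeal →
      ∀ {𝔓 : Ideal (absIntegers (𝓞 ℚ) ℚ)}, 𝔓 ∈ v.primesAbove →
        𝔓.inertia (absoluteGaloisGroup ℚ) ≤ U := by
    intro v hv 𝔓 h𝔓 τ hτ
    have hτH : τ ∈ κ.kerSubgroup := ZpExtension.inertia_le_kerSubgroup_holds ℚ p κ hv h𝔓 hτ
    have hτΛ : τ ∈ κ.layerSubgroup n := κ.kerSubgroup_le_layerSubgroup n hτH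
    refine (hmemU τ).2 ⟨hτΛ, ?_⟩
    have key := evalH1_resOfLe (κ.kerSubgroup_le_layerSubgroup n) htrivH htrivΛ y ⟨τ, hτH⟩
    rw [hy] at key
    have h0 : evalH1 htrivH ⟨τ, hτH⟩ c = 0 :=
      evalH1_eq_zero_of_mem_inertia_of_notMem htriv κ.kerSubgroup hc hv h𝔓 ⟨τ, hτH⟩ hτ
    change evalH1 htrivΛ (Subgroup.inclusion (κ.kerSubgroup_le_layerSubgroup n) ⟨τ, hτH⟩) y = 0
    rw [← key]
    exact h0
  have hNS : ramificationSubgroup ℚ {v : HeightOneSpectrum (𝓞 ℚ) | ((p : ℕ) : 𝓞 ℚ) ∈ v.asIdeal} ≤ N := by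
    have hNker : (QuotientGroup.mk' N).ker = N := QuotientGroup.ker_mk' N
    rw [← hNker]
    refine ramificationSubgroup_le_ker (QuotientGroup.mk' N) (by rw [hNker]; exact hNo) ?_
    intro v hv 𝔓 h𝔓 σ hσ
    rw [← MonoidHom.mem_ker, hNker, hN]
    -- every conjugate of `σ` is inertial above `v`, hence in `U`
    intro b
    have h1 : b * σ * b⁻¹ ∈ (b • 𝔓).inertia (absoluteGaloisGroup ℚ) := conj_mem_inertia_smul hσ b
    exact hIU hv (smul_mem_primesAbove h𝔓 b) h1
  -- Step 5: `Γ/N` is a `p`-group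
  have hΛidx : (κ.layerSubgroup n).index = p ^ n := κ.index_layerSubgroup n
  have hpowU : ∀ z : absoluteGaloisGroup ℚ, z ∈ κ.layerSubgroup n → z ^ p ^ k ∈ U := by
    intro z hz
    refine (hmemU _).2 ⟨(κ.layerSubgroup n).pow_mem hz _, ?_⟩
    have e : (⟨z ^ p ^ k, (κ.layerSubgroup n).pow_mem hz _⟩ : κ.layerSubgroup n) =
        (⟨z, hz⟩ : κ.layerSubgroup n) ^ p ^ k := Subtype.ext rfl
    rw [e, hφpow, hpM]
  have hNP : IsPGroup p (absoluteGaloisGroup ℚ ⧸ N) := by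
    intro q
    induction q using QuotientGroup.induction_on with
    | H g =>
      refine ⟨n + k, ?_⟩
      rw [← QuotientGroup.mk_pow, QuotientGroup.eq_one_iff, hN]
      have hgΛ : g ^ p ^ n ∈ κ.layerSubgroup n := by
        rw [← hΛidx]
        exact Subgroup.pow_index_mem (κ.layerSubgroup n) g
      intro b
      rw [pow_add, pow_mul, ← conj_pow]
      exact hpowU _ (hΛn.conj_mem _ hgΛ b)
  -- Step 6: `ker κ ≤ N ≤ U`, so `y` kills `ker κ` and `c = res y = 0`
  have hHN : κ.kerSubgroup ≤ N := kerSubgroup_le_of_isPGroup_quotient hp2 κ N hNo hNS hNP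
  have hzero : ∀ h : κ.kerSubgroup, evalH1 htrivH h c = 0 := by
    intro h
    have hhU : (h : absoluteGaloisGroup ℚ) ∈ U := hNU (hHN h.2)
    obtain ⟨hhΛ, h0⟩ := (hmemU _).1 hhU
    have key := evalH1_resOfLe (κ.kerSubgroup_le_layerSubgroup n) htrivH htrivΛ y h
    rw [hy] at key
    rw [key]
    exact h0
  exact ext_of_trivial htrivH fun h => by
    change evalH1 htrivH h c = evalH1 htrivH h 0
    rw [map_zero]
    exact hzero h

/-- Set form: under the same hypotheses the subgroup `unramifiedOutside (ker κ) Θ p ∅` is FINITE (it is `{0}`).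
[cite: Greenberg1999LNM, §5 Lemma 5.9 (p. 142)] -/
theorem finite_unramifiedOutside_kerSubgroup_of_trivial (hp2 : p ≠ 2) (κ : ZpExtension ℚ p)
    {Θ : Type} [AddCommGroup Θ] [DistribMulAction (absoluteGaloisGroup ℚ) Θ] [TopologicalSpace Θ]
    [DiscreteTopology Θ] (hcard : ∃ k : ℕ, Nat.card Θ = p ^ k)
    (htriv : ∀ (σ : absoluteGaloisGroup ℚ) (m : Θ), σ • m = m) :
    ((unramifiedOutside κ.kerSubgroup Θ p (∅ : Set (HeightOneSpectrum (𝓞 ℚ))) :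
      AddSubgroup (subgroupH1 κ.kerSubgroup Θ)) : Set (subgroupH1 κ.kerSubgroup Θ)).Finite := by
  rw [unramifiedOutside_kerSubgroup_eq_bot_of_trivial hp2 κ hcard htriv, AddSubgroup.coe_bot]
  exact Set.finite_singleton 0

/-! ## §4 Greenberg's Lemma 5.9 in the binder shape of the named fact, for trivial `Θ` -/

/-- **Greenberg, LNM 1716, §5 Lemma 5.9 — the case of a TRIVIAL module, PROVED.**  In the exact binder shape
of the named fact `IwasawaTheory.greenberg1999_lemma59_even_finite` (`p ≠ 2`, `κQ` cyclotomic, `#Θ = p`,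
continuous action, every complex conjugation acts trivially) with the extra hypothesis that ALL of `Γ_ℚ` acts
trivially on `Θ` (then the evenness and continuity binders hold automatically and are not used; nor is
`IsCyclotomic` — the statement holds for every `ℤ_p`-extension of `ℚ`): the classes of `H¹(Gal(ℚ̄/ℚ_∞), Θ)`
unramified at every place not above `p` form a finite set (indeed only the zero class,
`unramifiedOutside_kerSubgroup_eq_bot_of_trivial`).  This is the `θ = 𝟙` instance of Greenberg's «Otherwise,
`H¹(ℚ_Σ/ℚ_∞, Θ)` is finite» (for `θ = 𝟙` his `Y^θ = Gal(M_∞/ℚ_∞)` is `0`: `ℚ` is `p`-rational).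
[cite: Greenberg1999LNM, §5 Lemma 5.9 (p. 142 of the volume)] [cite: Washington1997, §13.1 Prop. 13.2] -/
theorem greenberg1999_lemma59_even_finite_of_trivial (p : ℕ) [Fact p.Prime] (hp2 : p ≠ 2)
    (κQ : ZpExtension ℚ p) (_hκ : κQ.IsCyclotomic)
    (Θ : Type) [AddCommGroup Θ] [DistribMulAction (absoluteGaloisGroup ℚ) Θ] [TopologicalSpace Θ]
    [DiscreteTopology Θ] (hΘ : Nat.card Θ = p)
    (_hcont : ∀ m : Θ, Continuous fun g : absoluteGaloisGroup ℚ ↦ g • m)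
    (_heven : ∀ c : absoluteGaloisGroup ℚ, IsComplexConjugation (Rat.castHom ℝ) c → ∀ m : Θ, c • m = m)
    (htriv : ∀ (σ : absoluteGaloisGroup ℚ) (m : Θ), σ • m = m) :
    (unramifiedOutside κQ.kerSubgroup Θ p ∅ : Set (subgroupH1 κQ.kerSubgroup Θ)).Finite :=
  finite_unramifiedOutside_kerSubgroup_of_trivial hp2 κQ ⟨1, by rw [pow_one]; exact hΘ⟩ htriv

end Literature.NumberTheory.IwasawaTheory.GreenbergCyclicOrderPTrivial

end
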